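import Literature.Analysis.FluidPDE.JiaSverak2014.Statements
import Literature.Analysis.Calculus.SimplifiedNewton
import HarnessLib

/-!
# Guillod–Šverák 2017/2023: the profile equation and the typed interface of a computer-assisted proof of a profile

Statement-level record, by cell pub-nsjs (papers/NavierStokesRegularity/ns-jia-sverak), of WHAT a computer-assisted
proof (CAP) of a scale-invariant Navier–Stokes profile in the setting of J. Guillod, V. Šverák, *Numerical
investigations of non-uniqueness for the Navier–Stokes initial value problem in borderline spaces*, J. Math. Fluid
Mech. 25 (2023) (arXiv:1704.00560; TeX line numbers refer to the arXiv source `paper.tex`) [GuillodSverak2023] has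
to deliver, and of the single published theorem that turns the delivered data into a profile. Nothing about the
Guillod–Šverák branch is asserted here: the file fixes the INTERFACE (the constants `K`, `M`, `ε` and the
inequality between them) so that the cell's verdict "the enclosure does not close" is a statement about named,
typed unknowns (pub-nsjs-profile GAP-v2.md: `ε` certified, `K` not computed).

## The profile equation (GŠ17 L211–215, eq. `ns-scale`), verbatim
"`ΔU + (x/2)·∇U + ½U − U·∇U − ∇P = 0`, `∇·U = 0` in `ℝ³`", with "`U(x) = u₀(x) + o(|x|⁻¹)` as `|x| → ∞`" (L217–219),
`u(t,x) = t^{−1/2} U(x/t^{1/2})` (L205–207). Multiplied by `−1` this is the tree's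
`IsForwardProfile 1 (1/2) U P` (`SelfSimilar.lean`: `−ΔU − ½U − ½(y·∇)U + (U·∇)U + ∇P = 0`, `div U = 0`, `U ∈ C²`,
`P ∈ C¹`), the form already used by `JiaSverak2014/Statements.lean` (`ProfileHyp`). The GŠ17 datum (L433–437) is
`u₀ = σ a₀`, `a₀(r,z) = e^{−4(z/r)²}(r²+z²)^{−1/2} e_θ`, a `−1`-homogeneous, smooth-off-`0`, divergence-free pure-swirl
field, i.e. an `IsHomogeneousDatum` in JS14's sense; it is NOT defined here (the interface below takes any
`IsHomogeneousDatum`).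

## The CAP interface
A CAP for the profile equation in a functional setting consists of (Newton–Kantorovich / radii-polynomial form;
GAP-v2.md "(F1)"):
* a Banach pair `(X, Y)` and the residual map `F : X → Y` (in applications `F = ℙ E`, `E` the profile residual,
  `ℙ` the Leray projector, `X` an `L²`-based space containing the Lipschitz-at-`0` finite candidate — CERTIFICATE.md
  caveat (ii));
* the realisation of `x ∈ X` as a velocity field and a pressure, with the guarantee that zeros of `F` are classical
  profiles with the datum's far field (`ProfileFunctionalSetting.zero_profileHyp`) — the analytic content of the
  functional setting (regularity of zeros, pressure in `L^q`), a HYPOTHESIS field here;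
* at an approximate zero `a` (the enclosed candidate `U_N`): the derivative `F'` on a ball, its value `A = F' a`
  invertible, and the three constants `K ≥ ‖A⁻¹‖`, `M` (Lipschitz constant of `F'` on the ball; for the quadratic
  residual `M = 2‖B‖`, `B` the bilinear part), `ε ≥ ‖F a‖`;
* the closing inequality `4 M K (K ε) ≤ 1` (`CAPData.closing`), which is the premise
  `4 M ‖A⁻¹‖ ‖A⁻¹ f(a)‖ ≤ 1` of the tree's kernel-checked simplified-Newton theorem
  `Literature.Analysis.Calculus.exists_zero_near_of_simplifiedNewton` (Magnus 2022, Prop. 6.7 (1)) once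
  `‖A⁻¹ f(a)‖ ≤ K ε` is used.

`profileHyp_of_capData` is then a modus ponens: the data give a zero `x⋆` with `‖x⋆ − a‖ ≤ 2Kε`, hence a profile
satisfying JS14/IJP26's hypotheses `ProfileHyp`. The theorem is trivial BY DESIGN: its value is that the
hypotheses of `CAPData` are exactly the list a CAP seat has to certify, with the constants named.

## Referee remark on the constant (GAPS.md G-A3)
GAP-v2.md states the closing inequality as `4 K² C_N ε < 1` with `‖B(h,h)‖ ≤ C_N‖h‖²` (quadratic-form bound). That
is the self-map condition of the radii polynomial `p(r) = Kε − r + K C_N r²`; in an infinite-dimensional `X` the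
fixed point needs a CONTRACTION, whose constant is the bilinear norm `‖B‖_{bil} ≥ C_N` (up to `2 C_N` by
polarisation), and the ball `B̄_{2Kε}(a)` route of the tree theorem needs `8 K² ‖B‖_{bil} ε ≤ 1` (`M = 2‖B‖_{bil}`).
The sharp radius `R₋` of Magnus Prop. 6.7 (1) is available through `existsUnique_zero_of_simplifiedNewton`
(conditions (i) `M R K < 1`, (ii) `M R² K + Kε ≤ R`); `CAPData` uses the convenient premise. Either way the
inequality is not satisfiable today: `K` has no certified bound for the cell's candidate (GAP-v2 O-2).

## What is deliberately NOT here
* No candidate, no numbers: `ε^U ≤ 0.0127883412507166855` (CERTIFICATE.md, 256×80, σ = 292) is a fact about an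
  explicit finite object and would enter as the value of `ε` once `(X, Y)`, `K`, `M` exist.
* No claim that the Guillod–Šverák branch exists beyond JS14's existence theorem (GŠ17 Thm 1 = JS14), nor anything
  about its spectrum (the cell's `JiaSverak2015/Divergence.lean` carries that as hypothesis structures).
* No definitions of `a₀`, of `ℙ`, of the function spaces — the interface is abstract on purpose.

## Mathlib / tree search
`lean search 'Kantorovich|radiiPolynomial|simplifiedNewton'`: the tree's `SimplifiedNewton.lean`
(`exists_zero_near_of_simplifiedNewton`, `existsUnique_zero_of_simplifiedNewton`) and the finite-dimensional
inf-sup variant `NewtonKantorovichInfSup.lean`; Mathlib has no Newton–Kantorovich theorem. `IsForwardProfile`,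
`ProfileHyp`, `IsHomogeneousDatum` are the tree's (`SelfSimilar.lean`, `JiaSverak2014/Statements.lean`).

## References
* J. Guillod, V. Šverák, J. Math. Fluid Mech. 25 (2023), arXiv:1704.00560: L205–219 (scale-invariant ansatz and
  profile equation), L433–437 (datum `a₀`), L279–283 (linearisation). [GuillodSverak2023]
* R. Magnus, *Metric Spaces: A Companion to Analysis* (2022), §6.6, Prop. 6.7. [Magnus2022]
* H. Jia, V. Šverák, Invent. Math. 196 (2014): existence of a profile for every datum (GŠ17 Thm 1). [JiaSverak2014]
-/

open MeasureTheory Set Metric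
open scoped ENNReal

namespace Literature.Analysis.FluidPDE.GuillodSverak2023

open Literature.Analysis.Calculus Literature.Analysis.FluidPDE.JiaSverak2014

/-- File-local notation, identical to `JiaSverak2014/Statements.lean`. -/
local notation "ℝ³" => EuclideanSpace ℝ (Fin 3)

variable {X Y : Type*} [NormedAddCommGroup X] [NormedSpace ℝ X] [NormedAddCommGroup Y] [NormedSpace ℝ Y]

/-- **A functional setting for the profile equation** (GŠ17 L211–219 in the form `IsForwardProfile 1 (1/2)`): a
residual map `F : X → Y` on a Banach pair, the realisation of `x ∈ X` as a velocity field `velocity x` and a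
pressure `pressure x`, the far-field datum `datum` (for GŠ17: `σ a₀`), and the guarantee that every zero of `F` is
a classical profile with that datum in the sense of `JiaSverak2014.ProfileHyp` (profile system, `P ∈ L^q`,
`|U − datum| ≲ ⟨x⟩⁻²`). The last field is the analytic content of the setting (elliptic regularity of zeros, the
Riesz pressure) and is a HYPOTHESIS: an instance must prove it for the concrete `(X, Y, F)`.
[cite: GuillodSverak2023, L211–219] -/
structure ProfileFunctionalSetting (X Y : Type*) [NormedAddCommGroup X] [NormedSpace ℝ X]
    [NormedAddCommGroup Y] [NormedSpace ℝ Y] where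
  /-- The residual map (`ℙ E` in applications). -/
  F : X → Y
  /-- Realisation as a velocity field. -/
  velocity : X → ℝ³ → ℝ³
  /-- Realisation as a pressure. -/
  pressure : X → ℝ³ → ℝ
  /-- The far-field datum (`σ a₀` for GŠ17). -/
  datum : ℝ³ → ℝ³
  /-- The datum is a JS14 datum (`−1`-homogeneous, smooth off `0`, divergence free off `0`). -/
  datum_ok : IsHomogeneousDatum datum
  /-- Zeros of `F` are classical profiles with the datum's far field, in IJP26's hypothesis class. -/
  zero_profileHyp : ∀ x : X, F x = 0 → ProfileHyp datum (velocity x) (pressure x)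

/-- **CAP data at an approximate zero** `a` (the enclosed finite candidate): the derivative `F'` of `S.F` on the
ball `B̄_{2Kε}(a)`, its value at `a` as an invertible operator `A`, the constants `K ≥ ‖A⁻¹‖`, `M` (Lipschitz
constant of `F'` on the ball), `ε ≥ ‖F a‖`, and the closing inequality `4 M K (K ε) ≤ 1`. Each field is a
certificate obligation of a CAP seat; `ε` is the quantity certified in pub-nsjs-profile/CERTIFICATE.md, `K` and
`M` are the open items of GAP-v2.md (O-2, O-4). [cite: Magnus2022, Prop. 6.7 (1)] -/
structure CAPData (S : ProfileFunctionalSetting X Y) where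
  /-- The approximate zero (candidate profile `U_N`). -/
  a : X
  /-- The derivative of `S.F` (wherever it is used: on the ball). -/
  F' : X → X →L[ℝ] Y
  /-- `A = F' a`, as a continuous linear equivalence (invertibility of the linearisation). -/
  A : X ≃L[ℝ] Y
  /-- Inverse bound `‖A⁻¹‖ ≤ K`. -/
  K : ℝ
  /-- Lipschitz constant of `F'` on the ball. -/
  M : ℝ
  /-- Residual bound `‖F a‖ ≤ ε`. -/
  ε : ℝ
  hM₀ : 0 ≤ M
  hK₀ : 0 ≤ K
  hε₀ : 0 ≤ ε
  /-- `S.F` is Fréchet differentiable with derivative `F' x` on `B̄_{2Kε}(a)`. -/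
  hasDeriv : ∀ x ∈ closedBall a (2 * (K * ε)), HasFDerivAt S.F (F' x) x
  /-- `F' a = A`. -/
  deriv_at : F' a = (A : X →L[ℝ] Y)
  /-- Centred Lipschitz estimate of the derivative on the ball. -/
  lipschitz : ∀ x ∈ closedBall a (2 * (K * ε)), ‖F' x - F' a‖ ≤ M * ‖x - a‖
  /-- `‖A⁻¹‖ ≤ K`. -/
  inverse_le : ‖(A.symm : Y →L[ℝ] X)‖ ≤ K
  /-- `‖F a‖ ≤ ε` (the certified defect). -/
  residual_le : ‖S.F a‖ ≤ ε
  /-- The closing inequality of the Newton–Kantorovich argument. -/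
  closing : 4 * M * K * (K * ε) ≤ 1

namespace CAPData

variable {S : ProfileFunctionalSetting X Y} (D : CAPData S)

/-- `‖A⁻¹ F(a)‖ ≤ K ε`. [folklore] -/
theorem norm_symm_apply_le : ‖D.A.symm (S.F D.a)‖ ≤ D.K * D.ε := by
  calc ‖D.A.symm (S.F D.a)‖ = ‖(D.A.symm : Y →L[ℝ] X) (S.F D.a)‖ := rfl
    _ ≤ ‖(D.A.symm : Y →L[ℝ] X)‖ * ‖S.F D.a‖ := ContinuousLinearMap.le_opNorm _ _
    _ ≤ D.K * D.ε := by
        apply mul_le_mul D.inverse_le D.residual_le (norm_nonneg _) D.hK₀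

/-- The ball of the tree theorem, `B̄_{2‖A⁻¹F(a)‖}(a)`, is contained in the ball `B̄_{2Kε}(a)` on which the data are
given. [folklore] -/
theorem closedBall_subset :
    closedBall D.a (2 * ‖D.A.symm (S.F D.a)‖) ⊆ closedBall D.a (2 * (D.K * D.ε)) :=
  closedBall_subset_closedBall (by linarith [D.norm_symm_apply_le])

/-- **Existence of a zero of `F` near the candidate** (kernel-checked modus ponens from
`exists_zero_near_of_simplifiedNewton`): `∃ x⋆`, `‖x⋆ − a‖ ≤ 2 K ε`, `F x⋆ = 0`, with `F' x⋆` invertible.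
[cite: Magnus2022, Prop. 6.7 (1)] -/
theorem exists_zero [CompleteSpace X] :
    ∃ x ∈ closedBall D.a (2 * (D.K * D.ε)), S.F x = 0 ∧ (D.F' x).IsInvertible := by
  have h4 : 4 * D.M * ‖(D.A.symm : Y →L[ℝ] X)‖ * ‖D.A.symm (S.F D.a)‖ ≤ 1 := by
    have h1 := D.inverse_le
    have h2 := D.norm_symm_apply_le
    have h3 := D.closing
    have hn1 : 0 ≤ ‖(D.A.symm : Y →L[ℝ] X)‖ := norm_nonneg _
    have hn2 : 0 ≤ ‖D.A.symm (S.F D.a)‖ := norm_nonneg _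
    have hM := D.hM₀
    have hK := D.hK₀
    have hε := D.hε₀
    calc 4 * D.M * ‖(D.A.symm : Y →L[ℝ] X)‖ * ‖D.A.symm (S.F D.a)‖
        ≤ 4 * D.M * D.K * (D.K * D.ε) := by
          apply mul_le_mul _ h2 hn2 (by positivity)
          apply mul_le_mul_of_nonneg_left h1 (by positivity)
      _ ≤ 1 := h3
  obtain ⟨x, hx, hfx, hinv, -, -⟩ :=
    exists_zero_near_of_simplifiedNewton (f := S.F) (f' := D.F') (a := D.a) (A := D.A) D.hM₀
      (fun x hx => D.hasDeriv x (D.closedBall_subset hx)) D.deriv_at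
      (fun x hx => D.lipschitz x (D.closedBall_subset hx)) h4
  exact ⟨x, D.closedBall_subset hx, hfx, hinv⟩

/-- **The CAP conclusion:** the data yield a classical profile with the datum's far field in IJP26's hypothesis
class, within `2Kε` of the candidate. Exactly the fields of `CAPData` and the setting's `zero_profileHyp` are
consumed. [folklore] -/
theorem profileHyp_of_capData [CompleteSpace X] :
    ∃ x ∈ closedBall D.a (2 * (D.K * D.ε)), ProfileHyp S.datum (S.velocity x) (S.pressure x) := by
  obtain ⟨x, hx, hfx, -⟩ := D.exists_zero
  exact ⟨x, hx, S.zero_profileHyp x hfx⟩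

end CAPData

end Literature.Analysis.FluidPDE.GuillodSverak2023
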